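import Literature.NumberTheory.Automorphic.BrandtModuleWeightSymm
import Literature.NumberTheory.Automorphic.BrandtIndexReducedNorm
import Literature.NumberTheory.Automorphic.QuaternionOrderIntegral
import HarnessLib

/-!
# Weight symmetry of Brandt matrices: the `n`-divisibility of sub-ideals of index `n²` from
# local principality at each prime

Topic `NumberTheory/Automorphic`; theorems only (no definition, no named fact, no instance).

The tree reduces Eichler's identity `w_j B(n)_ij = w_i B(n)_ji` (LNM 320 (1973), Ch. II §6,
Thm. 2 (17); named fact `brandtMatrix_weight_symm` of `BrandtModule.lean`) to the single
arithmetic input of Eichler's conjugate-ideal argument (`BrandtWeightSymmetry.lean`,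
`BrandtModuleWeightSymm.lean`, theorem `brandtMatrix_weight_symm_of_forall_nsmul_le`):

> (⋆) for invertible right `O`-ideals `I, J` and `α ∈ Bˣ` with `α I ⊆ J`, `[J : α I] = n²`,
> one has `n J ⊆ α I`

("an integral ideal of reduced norm `n` contains `n`", i.e. the integrality of the conjugate
ideal, Eichler loc. cit. (21)–(22)). This file proves (⋆) from the **local principality of the
invertible right ideals at each prime `p`**, in the finite form
`∃ x ∈ Bˣ, x O ⊆ I, p ∤ [I : x O]` (Kaplansky's theorem: invertible = locally principal, Voight,
*Quaternion Algebras*, Main Thm. 16.6.1), which is the genuinely local statement and is proved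
separately. The argument:

* `smul_le_of_forall_prime` — (⋆) for `M ⊆ I` with `[I : M] = n²` holds as soon as for every
  prime `p ∣ n` there is a unit `w` with `w I ⊆ M` and `p ∤ [M : w I]`: then `nrd(w) ∈ ℤ`,
  `nrd(w) I = w̄ (w I) ⊆ M` (`w̄ ∈ O_ℓ(M)`, orders being stable under the standard involution,
  tree `Brandt.IsOrder.standardInvolution_mem`) and `[I : w I] = nrd(w)² = n² [M : w I]`
  (tree `Brandt.cast_relIndex_units_smul_eq_reducedNorm_sq`), so `v_p(nrd w) = v_p(n)`; the
  generator of the ideal `{k ∈ ℤ : k I ⊆ M} ∋ n²` therefore divides `n`.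
* `exists_smul_le_not_dvd_of_locPrin` — such `w` exist when `I` and `M` are locally principal
  at `p`: `w = c y x⁻¹` with `x O ⊆ I`, `c = [I : x O]`, `y O ⊆ M`, and `[M : w I] = c³ [M : y O]`.
* `EichlerPackage.nsmul_le_of_locallyPrincipal`, `brandtMatrix_weight_symm_of_locallyPrincipal`
  — (⋆), hence `brandtMatrix_weight_symm`, for Eichler packages whose invertible right ideals are
  locally principal at every prime.

## References

* M. Eichler, *The basis problem for modular forms and the traces of the Hecke operators*, LNM 320
  (1973), Ch. II §6, Thm. 2 (17) and its proof, (21)–(22) [Eichler1973].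
* J. Voight, *Quaternion Algebras*, GTM 288 (2021), Main Thm. 16.6.1, §41.1 [Voight2021].
* M.-F. Vignéras, LNM 800 (1980), Ch. I §4 (Lemme 4.1, 4.12; norme réduite d'un idéal)
  [VignerasLNM800].
-/

noncomputable section

open scoped Pointwise

universe u

namespace Literature.NumberTheory.Automorphic

namespace BrandtModule

/-! ### The key containment `n I ⊆ M` from local data -/

section KeyContainment

variable {B : Type u} [Ring B] [Algebra ℚ B] [IsQuaternionAlgebra ℚ B]

/-- For a unit `w` with `w I ⊆ M ⊆ I` (`I, M` full lattices of a quaternion algebra over `ℚ`),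
`nrd(w)` is an integer `m` with `m I ⊆ M`: `m x = w̄ (w x)` and `w̄ ∈ O_ℓ(M)` since orders are
stable under the standard involution. [cite: VignerasLNM800, Ch. I §4 Lemme 4.1 and Lemme 4.12] -/
theorem exists_int_reducedNorm_and_smul_le {I M : Submodule ℤ B} (hI : IsFullLattice B I)
    (hM : IsFullLattice B M) (hMI : M ≤ I) {w : Bˣ} (hw : w • I ≤ M) :
    ∃ m : ℤ, reducedNorm ℚ B w = m ∧ ∀ x ∈ I, m • x ∈ M := by
  haveI : IsAddTorsionFree B := isAddTorsionFree_of_charZero_module ℚ B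
  -- `w ∈ O_ℓ(I)` and `w ∈ O_ℓ(M)`
  have hwI : (w : B) ∈ Brandt.leftOrder I :=
    (Brandt.units_smul_le_iff_mem_leftOrder I w).mp (hw.trans hMI)
  have hwM : (w : B) ∈ Brandt.leftOrder M := by
    refine (Brandt.units_smul_le_iff_mem_leftOrder M w).mp ?_
    exact (units_smul_mono w hMI).trans hw
  have hOI : Brandt.IsOrder B (Brandt.leftOrder I) := Brandt.isOrder_leftOrder hI
  have hOM : Brandt.IsOrder B (Brandt.leftOrder M) := Brandt.isOrder_leftOrder hM
  obtain ⟨-, m, -, hm⟩ := hOI.exists_int_reducedTrace_reducedNorm hwI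
  refine ⟨m, hm, fun x hx => ?_⟩
  have hbar : standardInvolution ℚ B w ∈ Brandt.leftOrder M := hOM.standardInvolution_mem hwM
  have hwx : (w : B) * x ∈ M := hw (Submodule.smul_mem_pointwise_smul x w I hx)
  have key : standardInvolution ℚ B w * ((w : B) * x) ∈ M := hbar _ hwx
  rw [← mul_assoc, IsQuaternionAlgebra.standardInvolution_mul, hm, Algebra.algebraMap_eq_smul_one,
    smul_mul_assoc, one_mul] at key
  have : ((m : ℚ)) • x = m • x := Int.cast_smul_eq_zsmul ℚ m x
  rwa [this] at key

omit [Algebra ℚ B] [IsQuaternionAlgebra ℚ B] in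
/-- `[I : M] · x ∈ M` for `x ∈ I` (Lagrange in the finite group `I / (M ∩ I)`). [folklore] -/
theorem relIndex_smul_mem (I M : Submodule ℤ B) (x : B) (hx : x ∈ I) :
    (M.toAddSubgroup.relIndex I.toAddSubgroup : ℤ) • x ∈ M := by
  have h := AddSubgroup.nsmul_relIndex_mem M.toAddSubgroup (K := I.toAddSubgroup) hx
  rw [natCast_zsmul]
  exact h

/-- **The key containment from local data.** Let `M ⊆ I` be full lattices with `[I : M] = n²`,
`n ≠ 0`, and suppose that for every prime `p ∣ n` there is a unit `w` with `w I ⊆ M` and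
`p ∤ [M : w I]`. Then `n I ⊆ M`. (For each `p`, `nrd(w) I ⊆ M` with `[I : wI] = nrd(w)² = n² [M : wI]`,
so `v_p(nrd w) = v_p(n)`; the generator of the ideal `{k : k I ⊆ M} ∋ n²` of `ℤ` therefore divides
`n`.) This is the statement "an integral ideal of reduced norm `n` contains `n`" behind Eichler's
passage to the conjugate ideal. [cite: Eichler1973, Ch. II §6, proof of Thm. 2 (17), (21)–(22)] -/
theorem smul_le_of_forall_prime {I M : Submodule ℤ B} (hI : IsFullLattice B I)
    (hM : IsFullLattice B M) (hMI : M ≤ I) {n : ℕ} (hn : n ≠ 0)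
    (hidx : M.toAddSubgroup.relIndex I.toAddSubgroup = n ^ 2)
    (hloc : ∀ p : ℕ, p.Prime → p ∣ n → ∃ w : Bˣ, w • I ≤ M ∧
      ¬ p ∣ (w • I).toAddSubgroup.relIndex M.toAddSubgroup) :
    ∀ x ∈ I, (n : ℤ) • x ∈ M := by
  classical
  -- the transporter ideal `{k : k I ⊆ M}` of `ℤ` is principal, generated by `d`
  let 𝔞 : Ideal ℤ :=
    { carrier := {k | ∀ x ∈ I, k • x ∈ M}
      add_mem' := fun {a b} ha hb x hx => by
        rw [add_smul]
        exact M.add_mem (ha x hx) (hb x hx)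
      zero_mem' := fun x _ => by
        rw [zero_smul]
        exact M.zero_mem
      smul_mem' := fun c {k} hk x hx => by
        rw [smul_eq_mul, mul_smul]
        exact M.smul_mem c (hk x hx) }
  have hmem𝔞 : ∀ k : ℤ, k ∈ 𝔞 ↔ ∀ x ∈ I, k • x ∈ M := fun k => Iff.rfl
  obtain ⟨d, hd⟩ := (Submodule.IsPrincipal.principal 𝔞 : ∃ d, 𝔞 = Ideal.span {d})
  have hmem : ∀ k : ℤ, (∀ x ∈ I, k • x ∈ M) ↔ d ∣ k := fun k => by
    rw [← hmem𝔞, hd, Ideal.mem_span_singleton]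
  -- `n² ∈ 𝔞`
  have hn2 : d ∣ ((n ^ 2 : ℕ) : ℤ) := (hmem _).mp fun x hx => by
    rw [← hidx]
    exact relIndex_smul_mem I M x hx
  have hd0 : d ≠ 0 := by
    rintro rfl
    rw [zero_dvd_iff] at hn2
    exact pow_ne_zero 2 hn (by exact_mod_cast hn2)
  -- it suffices that `d ∣ n`, i.e. `|d| ∣ n`, checked prime by prime on factorizations
  suffices hdn : d ∣ (n : ℤ) from fun x hx => ((hmem _).mpr hdn) x hx
  rw [← Int.natAbs_dvd_natAbs, Int.natAbs_natCast]
  have hdabs : d.natAbs ≠ 0 := Int.natAbs_ne_zero.mpr hd0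
  have hdn2 : d.natAbs ∣ n ^ 2 := by
    rwa [← Int.natAbs_dvd_natAbs, Int.natAbs_natCast] at hn2
  rw [← Nat.factorization_le_iff_dvd hdabs hn, Finsupp.le_def]
  intro p
  by_cases hp : p.Prime
  swap
  · simp [Nat.factorization_eq_zero_of_not_prime _ hp]
  by_cases hpn : p ∣ n
  swap
  · -- `v_p(|d|) ≤ v_p(n²) = 2 v_p(n) = 0`
    have h1 : d.natAbs.factorization p ≤ (n ^ 2).factorization p :=
      (Finsupp.le_def.mp ((Nat.factorization_le_iff_dvd hdabs (pow_ne_zero 2 hn)).mpr hdn2)) p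
    rw [Nat.factorization_pow, Finsupp.smul_apply, Nat.factorization_eq_zero_of_not_dvd hpn,
      smul_zero] at h1
    exact h1.trans (Nat.zero_le _)
  -- `p ∣ n`: use the local datum `w`
  obtain ⟨w, hwle, hndvd⟩ := hloc p hp hpn
  obtain ⟨m, hm, hmI⟩ := exists_int_reducedNorm_and_smul_le hI hM hMI hwle
  set c := (w • I).toAddSubgroup.relIndex M.toAddSubgroup with hc
  have hc0 : c ≠ 0 := fun h0 => hndvd (by rw [h0]; exact dvd_zero p)
  -- `[I : wI] = c n²` and `[I : wI] = nrd(w)² = m²`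
  have hwI : (w : B) ∈ Brandt.leftOrder I :=
    (Brandt.units_smul_le_iff_mem_leftOrder I w).mp (hwle.trans hMI)
  have hchain : c * n ^ 2 = (w • I).toAddSubgroup.relIndex I.toAddSubgroup := by
    rw [← hidx]
    exact AddSubgroup.relIndex_mul_relIndex _ _ _ (Submodule.toAddSubgroup_mono hwle)
      (Submodule.toAddSubgroup_mono hMI)
  have hcast := Brandt.cast_relIndex_units_smul_eq_reducedNorm_sq hI hwI
  rw [← hchain, hm] at hcast
  have hmn : m.natAbs ^ 2 = c * n ^ 2 := by
    have h' : ((c * n ^ 2 : ℕ) : ℤ) = m ^ 2 := by exact_mod_cast hcast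
    have := congrArg Int.natAbs h'
    rwa [Int.natAbs_natCast, Int.natAbs_pow, eq_comm] at this
  have hm0 : m.natAbs ≠ 0 := by
    intro h0
    rw [h0, zero_pow two_ne_zero, eq_comm, mul_eq_zero] at hmn
    rcases hmn with h | h
    · exact hc0 h
    · exact pow_ne_zero 2 hn h
  -- compare valuations: `2 v_p(|m|) = v_p(c) + 2 v_p(n) = 2 v_p(n)`
  have hval : m.natAbs.factorization p = n.factorization p := by
    have := congrArg (fun k : ℕ => k.factorization p) hmn
    simp only [Nat.factorization_pow, Finsupp.smul_apply, smul_eq_mul,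
      Nat.factorization_mul hc0 (pow_ne_zero 2 hn), Finsupp.add_apply,
      Nat.factorization_eq_zero_of_not_dvd hndvd, zero_add] at this
    omega
  -- `d ∣ m`
  have hdm : d.natAbs ∣ m.natAbs := Int.natAbs_dvd_natAbs.mpr ((hmem m).mp hmI)
  have h2 := (Finsupp.le_def.mp ((Nat.factorization_le_iff_dvd hdabs hm0).mpr hdm)) p
  rwa [hval] at h2

end KeyContainment

/-! ### Local data from local principality of `I` and `M` separately -/

section LocalData

variable {B : Type u} [Ring B] [Algebra ℚ B] [IsQuaternionAlgebra ℚ B]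

/-- For a full lattice `I` of a quaternion algebra over `ℚ` and a unit `u = c ∈ ℕ` (a scalar),
`[I : c I] = c⁴` (`= nrd(c)² = (c²)²`). [folklore] -/
theorem relIndex_natCast_units_smul {I : Submodule ℤ B} (hI : IsFullLattice B I) {c : ℕ} {u : Bˣ}
    (hu : (u : B) = c) : (u • I).toAddSubgroup.relIndex I.toAddSubgroup = c ^ 4 := by
  have hmem : (u : B) ∈ Brandt.leftOrder I := fun y hy => by
    rw [hu, ← nsmul_eq_mul]
    exact I.smul_of_tower_mem c hy
  have h := Brandt.cast_relIndex_units_smul_eq_reducedNorm_sq hI hmem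
  rw [hu, show ((c : ℕ) : B) = algebraMap ℚ B (c : ℚ) by rw [map_natCast],
    reducedNorm_algebraMap_rat, ← pow_mul] at h
  exact_mod_cast h

omit [Algebra ℚ B] [IsQuaternionAlgebra ℚ B] in
/-- A scalar unit `u = c` moves `I` into any `P ⊇ c I`: `u • I ≤ P`. [folklore] -/
theorem natCast_units_smul_le {I P : Submodule ℤ B} {c : ℕ} {u : Bˣ} (hu : (u : B) = c)
    (h : ∀ x ∈ I, (c : ℤ) • x ∈ P) : u • I ≤ P := by
  intro z hz
  obtain ⟨x, hx, rfl⟩ := (Submodule.mem_smul_pointwise_iff_exists z u I).mp hz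
  rw [Units.smul_def, hu, smul_eq_mul, ← nsmul_eq_mul, ← natCast_zsmul]
  exact h x hx

/-- **Local data at `p` from local principality of `I` and `M`.** Let `M ⊆ I` be lattices of a
quaternion algebra over `ℚ`, `I` full, `M` a right `O`-module, and suppose `x O ⊆ I` with
`p ∤ c := [I : x O]` and `y O ⊆ M` with `p ∤ [M : y O]` (`x, y` units). Then `w := y x⁻¹ c`
satisfies `w I ⊆ M` and `p ∤ [M : w I] = c³ [M : y O]`. [folklore] -/
theorem exists_smul_le_not_dvd_of_locPrin {O I M : Submodule ℤ B} (hI : IsFullLattice B I)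
    {p : ℕ} (hp : p.Prime) {x y : Bˣ} (hxO : x • O ≤ I)
    (hpx : ¬ p ∣ (x • O).toAddSubgroup.relIndex I.toAddSubgroup) (hyO : y • O ≤ M)
    (hpy : ¬ p ∣ (y • O).toAddSubgroup.relIndex M.toAddSubgroup) :
    ∃ w : Bˣ, w • I ≤ M ∧ ¬ p ∣ (w • I).toAddSubgroup.relIndex M.toAddSubgroup := by
  set c := (x • O).toAddSubgroup.relIndex I.toAddSubgroup with hc
  have hc0 : c ≠ 0 := fun h0 => hpx (by rw [h0]; exact dvd_zero p)
  -- the scalar unit `u = c`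
  let u : Bˣ := Units.map (algebraMap ℚ B : ℚ →+* B).toMonoidHom
    (Units.mk0 (c : ℚ) (by exact_mod_cast hc0))
  have hu : (u : B) = c := by
    simp [u]
  -- `c I ⊆ x O`
  have hcI : u • I ≤ x • O := natCast_units_smul_le hu fun z hz => relIndex_smul_mem I (x • O) z hz
  refine ⟨y * x⁻¹ * u, ?_, ?_⟩
  · -- `w I = y x⁻¹ (c I) ⊆ y x⁻¹ x O = y O ⊆ M`
    rw [mul_smul, mul_smul]
    refine le_trans (units_smul_mono y (units_smul_mono x⁻¹ hcI)) ?_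
    rw [inv_smul_smul]
    exact hyO
  · -- `[M : w I] = [M : y O] · [y O : w I]`, `[y O : w I] = [x O : c I] = c³`
    have hle1 : (y * x⁻¹ * u) • I ≤ y • O := by
      rw [mul_smul, mul_smul]
      refine le_trans (units_smul_mono y (units_smul_mono x⁻¹ hcI)) ?_
      rw [inv_smul_smul]
    have hr : (u • I).toAddSubgroup.relIndex (x • O).toAddSubgroup = c ^ 3 := by
      have h4 : (u • I).toAddSubgroup.relIndex I.toAddSubgroup = c ^ 4 :=
        relIndex_natCast_units_smul hI hu
      have hchain := AddSubgroup.relIndex_mul_relIndex (u • I).toAddSubgroup (x • O).toAddSubgroup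
        I.toAddSubgroup (Submodule.toAddSubgroup_mono hcI) (Submodule.toAddSubgroup_mono hxO)
      rw [h4, ← hc, pow_succ] at hchain
      exact mul_right_cancel₀ hc0 hchain
    have hstep : ((y * x⁻¹ * u) • I).toAddSubgroup.relIndex (y • O).toAddSubgroup = c ^ 3 := by
      have := relIndex_units_smul (y * x⁻¹) (u • I) (x • O)
      rw [mul_smul y x⁻¹ (x • O), inv_smul_smul, ← mul_smul] at this
      rw [this, hr]
    have hchain := AddSubgroup.relIndex_mul_relIndex ((y * x⁻¹ * u) • I).toAddSubgroup
      (y • O).toAddSubgroup M.toAddSubgroup (Submodule.toAddSubgroup_mono hle1)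
      (Submodule.toAddSubgroup_mono hyO)
    rw [← hchain, hstep]
    intro hdvd
    rcases (Nat.Prime.dvd_mul hp).mp hdvd with h | h
    · exact hpx (hp.dvd_of_dvd_pow h)
    · exact hpy h

end LocalData

/-! ### (⋆) and the weight symmetry for Eichler packages -/

section Packages

variable {Nplus Nminus : ℕ}

/-- **(⋆) from local principality.** For an Eichler package `P` whose invertible right
`P.O`-ideals are locally principal at every prime (`∃ x ∈ Bˣ, x O ⊆ I, p ∤ [I : x O]`): for all
invertible right ideals `I, J`, every translate `α I ⊆ J` of index `n²` contains `n J`. [cite: Eichler1973, Ch. II §6, proof of Thm. 2 (17), (21)–(22)] -/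
theorem _root_.Literature.NumberTheory.Automorphic.EichlerPackage.nsmul_le_of_locallyPrincipal
    (P : EichlerPackage Nplus Nminus)
    (hLP : ∀ I ∈ Brandt.rightIdeals P.O, ∀ p : ℕ, p.Prime →
      ∃ x : P.Bˣ, x • P.O ≤ I ∧ ¬ p ∣ (x • P.O).toAddSubgroup.relIndex I.toAddSubgroup) :
    ∀ I ∈ Brandt.rightIdeals P.O, ∀ J ∈ Brandt.rightIdeals P.O, ∀ (α : P.Bˣ) (n : ℕ),
      α • I ≤ J → (α • I).toAddSubgroup.relIndex J.toAddSubgroup = n ^ 2 →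
        ∀ y ∈ J, (n : ℤ) • y ∈ α • I := by
  have hO : IsZOrder P.O := P.isEichlerOrder.isZOrder
  have h : Brandt.rightIdeals P.O = invertibleRightIdeals P.O :=
    rightIdeals_eq_invertibleRightIdeals_of_isTotallyDefinite P.isTotallyDefinite hO
  intro I hI J hJ α n hle hidx
  by_cases hn : n = 0
  · intro y _
    rw [hn, Nat.cast_zero, zero_smul]
    exact Submodule.zero_mem _
  have hαI : α • I ∈ Brandt.rightIdeals P.O := by
    rw [h, mem_invertibleRightIdeals_iff] at hI ⊢
    exact hI.units_smul α
  refine smul_le_of_forall_prime hJ.1 hαI.1 hle hn hidx fun p hp _ => ?_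
  obtain ⟨x, hxO, hpx⟩ := hLP J hJ p hp
  obtain ⟨y, hyO, hpy⟩ := hLP (α • I) hαI p hp
  exact exists_smul_le_not_dvd_of_locPrin hJ.1 hp hxO hpx hyO hpy

/-- **Eichler's weight symmetry (17) from local principality**: if in every Eichler package
every invertible right ideal of the Eichler order is locally principal at every prime
(Kaplansky's theorem), then `w_j B(n)_ij = w_i B(n)_ji`, i.e. the named fact
`brandtMatrix_weight_symm` holds (via the tree's `brandtMatrix_weight_symm_of_forall_nsmul_le`). [cite: Eichler1973, Ch. II §6 Thm. 2 eq. (17)] -/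
theorem _root_.Literature.NumberTheory.Automorphic.brandtMatrix_weight_symm_of_locallyPrincipal
    (hLP : ∀ (Nplus Nminus : ℕ) (P : EichlerPackage Nplus Nminus),
      ∀ I ∈ Brandt.rightIdeals P.O, ∀ p : ℕ, p.Prime →
        ∃ x : P.Bˣ, x • P.O ≤ I ∧ ¬ p ∣ (x • P.O).toAddSubgroup.relIndex I.toAddSubgroup) :
    brandtMatrix_weight_symm :=
  brandtMatrix_weight_symm_of_forall_nsmul_le fun Nplus Nminus P =>
    P.nsmul_le_of_locallyPrincipal (hLP Nplus Nminus P)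

end Packages

end BrandtModule

end Literature.NumberTheory.Automorphic

end
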